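import Mathlib
import HarnessLib
import Summits.ValiantsHypothesis.ValiantsHypothesis.Theorems.LacunarySymmetroidMatrixDescartesOsculationLawPeelLeftEnds
import Summits.ValiantsHypothesis.ValiantsHypothesis.Theorems.LacunarySymmetroidMatrixDescartesOsculationLawPeelMaximalBranch

/-!
# ValiantsHypothesis / LacunarySymmetroid — crux `MatrixDescartes` (stmt-ValiantsHypothesis-18050, V1),
# line `Cruxes/MatrixDescartes/Lines/osculation_law.lean` («osculation-law»), stub `stub_peel` (ALL ranks):
# THE MAXIMAL LEFT CONTINUATION OF A BRANCH (rank-free; left mirror of `…PeelMaximalBranch`, piece (α) of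
# NOTE-p7g12-peel-general-r-sizing.md)

From a curve point `(t₀, b₀)` of the open quadrant the continuous positive solution continues to the LEFT maximally inside
`t > 0`: either down to every `(T, t₀]`, `T > 0` (the branch reaches `t → 0⁺`), or down to an abscissa `0 < α < t₀` where it
tends to `0` (ZERO end) or to `+∞` (ESCAPE end).  Assembly of `exists_local_branch_of_hyperbolic`,
`branch_unique_of_hyperbolic`, `exists_extension_of_tendsto_left`, `not_oscillating_left_end`, `tendsto_of_not_oscillating`.

* **`exists_left_maximal_branch`**.

Honest framing: a rank-free LEMMA toward the OPEN stub `stub_peel` (all `r`); nothing of the summit is proved; `VP ≠ VNP` is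
NOT proved.  No definitions, no named facts.
-/

-- `Summit.ValiantsHypothesis.ValiantsHypothesis.…` is the tree's mandated single-conjunct layout (Sub = Summit).
set_option linter.dupNamespace false

noncomputable section

namespace Summit.ValiantsHypothesis.ValiantsHypothesis.Theorems.LacunarySymmetroidMatrixDescartes

open Polynomial Set Filter
open MvPolynomial (pderiv)
open scoped BigOperators Topology

namespace OsculationPeel

/-- **The maximal left continuation of a branch** (inside `t > 0`). [folklore] -/
theorem exists_left_maximal_branch (Φ : MvPolynomial (Fin 2) ℝ) (P : ℝ → ℝ[X])
    (hP : ∀ t b, (P t).eval b = MvPolynomial.eval ![t, b] Φ) (hsplit : ∀ t, 0 < t → (P t).Splits)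
    (hfin : {p : Fin 2 → ℝ | 0 < p 0 ∧ 0 < p 1 ∧ MvPolynomial.eval p Φ = 0 ∧
      MvPolynomial.eval p
        (MvPolynomial.X 0 * MvPolynomial.pderiv 0 (MvPolynomial.X 0 * MvPolynomial.pderiv 0 Φ)
            * (MvPolynomial.X 1 * MvPolynomial.pderiv 1 Φ) ^ 2
          - 2 * (MvPolynomial.X 0 * MvPolynomial.pderiv 0 (MvPolynomial.X 1 * MvPolynomial.pderiv 1 Φ))
            * (MvPolynomial.X 0 * MvPolynomial.pderiv 0 Φ) * (MvPolynomial.X 1 * MvPolynomial.pderiv 1 Φ)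
          + MvPolynomial.X 1 * MvPolynomial.pderiv 1 (MvPolynomial.X 1 * MvPolynomial.pderiv 1 Φ)
            * (MvPolynomial.X 0 * MvPolynomial.pderiv 0 Φ) ^ 2) = 0}.Finite)
    (hgp : ∀ p ∈ {p : Fin 2 → ℝ | 0 < p 0 ∧ 0 < p 1 ∧ MvPolynomial.eval p Φ = 0 ∧
      MvPolynomial.eval p
        (MvPolynomial.X 0 * MvPolynomial.pderiv 0 (MvPolynomial.X 0 * MvPolynomial.pderiv 0 Φ)
            * (MvPolynomial.X 1 * MvPolynomial.pderiv 1 Φ) ^ 2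
          - 2 * (MvPolynomial.X 0 * MvPolynomial.pderiv 0 (MvPolynomial.X 1 * MvPolynomial.pderiv 1 Φ))
            * (MvPolynomial.X 0 * MvPolynomial.pderiv 0 Φ) * (MvPolynomial.X 1 * MvPolynomial.pderiv 1 Φ)
          + MvPolynomial.X 1 * MvPolynomial.pderiv 1 (MvPolynomial.X 1 * MvPolynomial.pderiv 1 Φ)
            * (MvPolynomial.X 0 * MvPolynomial.pderiv 0 Φ) ^ 2) = 0},
        MvPolynomial.eval p (MvPolynomial.pderiv 1 Φ) ≠ 0)
    {t₀ b₀ : ℝ} (ht₀ : 0 < t₀) (hb₀ : 0 < b₀) (hΦ : MvPolynomial.eval ![t₀, b₀] Φ = 0) :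
    ∃ β : ℝ → ℝ, β t₀ = b₀ ∧
      ((∀ T, 0 < T → T < t₀ → ContinuousOn β (Ioc T t₀) ∧ ∀ t ∈ Ioc T t₀, 0 < β t ∧ MvPolynomial.eval ![t, β t] Φ = 0) ∨
       ∃ α, 0 < α ∧ α < t₀ ∧ ContinuousOn β (Ioc α t₀) ∧ (∀ t ∈ Ioc α t₀, 0 < β t ∧ MvPolynomial.eval ![t, β t] Φ = 0) ∧
         (Tendsto β (𝓝[>] α) (𝓝 0) ∨ Tendsto β (𝓝[>] α) atTop)) := by
  classical
  set S : Set ℝ := {T | 0 ≤ T ∧ T < t₀ ∧ ∃ γ : ℝ → ℝ, γ t₀ = b₀ ∧ ContinuousOn γ (Ioc T t₀) ∧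
    ∀ t ∈ Ioc T t₀, 0 < γ t ∧ MvPolynomial.eval ![t, γ t] Φ = 0} with hSdef
  have hbdd : BddBelow S := ⟨0, fun T hT => hT.1⟩
  -- Step 1: nonempty
  have hne : S.Nonempty := by
    obtain ⟨ψ, hψ0, hψcd, hψsol, -⟩ := exists_local_branch_of_hyperbolic Φ P hP hsplit hfin hgp ht₀ hb₀ hΦ
    have hψca : ∀ᶠ t in 𝓝 t₀, ContinuousAt ψ t := (hψcd.eventually (by simp)).mono fun t ht => ht.continuousAt
    have hψpos : ∀ᶠ t in 𝓝 t₀, 0 < ψ t := by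
      have h := hψcd.continuousAt.tendsto
      rw [hψ0] at h
      exact h.eventually (Ioi_mem_nhds hb₀)
    obtain ⟨δ, hδ, h₁⟩ : ∃ δ > 0, ∀ t, dist t t₀ < δ →
        ContinuousAt ψ t ∧ MvPolynomial.eval ![t, ψ t] Φ = 0 ∧ 0 < ψ t :=
      Metric.eventually_nhds_iff.1 ((hψca.and hψsol).and hψpos |>.mono fun t h => ⟨h.1.1, h.1.2, h.2⟩)
    have hd : ∀ t ∈ Ioc (max (t₀ - δ) 0) t₀, dist t t₀ < δ := fun t ht => by
      rw [Real.dist_eq, abs_lt]; constructor <;> linarith [ht.1, ht.2, le_max_left (t₀ - δ) 0, (max_lt_iff.1 (ht.1)).1]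
    refine ⟨max (t₀ - δ) 0, le_max_right _ _, max_lt (by linarith) ht₀, ψ, hψ0,
      fun t ht => (h₁ t (hd t ht)).1.continuousWithinAt, fun t ht => ⟨(h₁ t (hd t ht)).2.2, (h₁ t (hd t ht)).2.1⟩⟩
  -- Step 2: uniqueness on the common interval
  have huniq : ∀ T T' (γ γ' : ℝ → ℝ), 0 ≤ T → 0 ≤ T' → (γ t₀ = b₀ ∧ ContinuousOn γ (Ioc T t₀) ∧
      ∀ t ∈ Ioc T t₀, 0 < γ t ∧ MvPolynomial.eval ![t, γ t] Φ = 0) →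
      (γ' t₀ = b₀ ∧ ContinuousOn γ' (Ioc T' t₀) ∧ ∀ t ∈ Ioc T' t₀, 0 < γ' t ∧ MvPolynomial.eval ![t, γ' t] Φ = 0) →
      ∀ t, t ≤ t₀ → T < t → T' < t → γ t = γ' t := by
    intro T T' γ γ' hT0 hT0' hγ hγ' t h0 hT hT'
    have hsub : Icc t t₀ ⊆ Ioc T t₀ := fun u hu => ⟨hT.trans_le hu.1, hu.2⟩
    have hsub' : Icc t t₀ ⊆ Ioc T' t₀ := fun u hu => ⟨hT'.trans_le hu.1, hu.2⟩
    exact branch_unique_of_hyperbolic Φ P hP hsplit hfin hgp (hT0.trans_lt hT) (right_mem_Icc.2 h0) (hγ.2.1.mono hsub)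
      (hγ'.2.1.mono hsub') (fun u hu => (hγ.2.2 u (hsub hu)).1) (fun u hu => (hγ.2.2 u (hsub hu)).2)
      (fun u hu => (hγ'.2.2 u (hsub' hu)).2) (hγ.1.trans hγ'.1.symm) (left_mem_Icc.2 h0)
  -- Step 3: glue
  have hw : ∀ T ∈ S, ∃ γ : ℝ → ℝ, γ t₀ = b₀ ∧ ContinuousOn γ (Ioc T t₀) ∧
      ∀ t ∈ Ioc T t₀, 0 < γ t ∧ MvPolynomial.eval ![t, γ t] Φ = 0 := fun T hT => hT.2.2
  let β : ℝ → ℝ := fun t =>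
    if h : ∃ T, T ∈ S ∧ T < t then Classical.choose (hw _ (Classical.choose_spec h).1) t else b₀
  have hβeq : ∀ T ∈ S, ∀ γ : ℝ → ℝ, (γ t₀ = b₀ ∧ ContinuousOn γ (Ioc T t₀) ∧
      ∀ t ∈ Ioc T t₀, 0 < γ t ∧ MvPolynomial.eval ![t, γ t] Φ = 0) → ∀ t ∈ Ioc T t₀, β t = γ t := by
    intro T hT γ hγ t ht
    have h : ∃ T, T ∈ S ∧ T < t := ⟨T, hT, ht.1⟩
    show (if h : ∃ T, T ∈ S ∧ T < t then Classical.choose (hw _ (Classical.choose_spec h).1) t else b₀) = γ t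
    rw [dif_pos h]
    exact huniq _ _ _ _ (Classical.choose_spec h).1.1 hT.1 (Classical.choose_spec (hw _ (Classical.choose_spec h).1))
      hγ t ht.2 (Classical.choose_spec h).2 ht.1
  have hβadm : ∀ T ∈ S, β t₀ = b₀ ∧ ContinuousOn β (Ioc T t₀) ∧
      ∀ t ∈ Ioc T t₀, 0 < β t ∧ MvPolynomial.eval ![t, β t] Φ = 0 := by
    intro T hT
    obtain ⟨γ, hγ⟩ := hw T hT
    have hE : EqOn β γ (Ioc T t₀) := fun t ht => hβeq T hT γ hγ t ht
    refine ⟨?_, hγ.2.1.congr hE, fun t ht => ?_⟩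
    · rw [hE ⟨hT.2.1, le_rfl⟩, hγ.1]
    · rw [hE ht]; exact hγ.2.2 t ht
  have hβ0 : β t₀ = b₀ := by
    obtain ⟨T, hT⟩ := hne
    exact (hβadm T hT).1
  have hup : ∀ T T', T' ∈ S → T' ≤ T → T < t₀ → T ∈ S := by
    intro T T' hT'S hle hT
    obtain ⟨γ, hγ0, hγc, hγs⟩ := hT'S.2.2
    exact ⟨hT'S.1.trans hle, hT, γ, hγ0, hγc.mono (Ioc_subset_Ioc_left hle), fun t ht => hγs t ⟨hle.trans_lt ht.1, ht.2⟩⟩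
  refine ⟨β, hβ0, ?_⟩
  set α := sInf S with hα
  have hα0 : 0 ≤ α := le_csInf hne fun T hT => hT.1
  rcases hα0.eq_or_lt with hzero | hpos
  · -- `inf S = 0`: the branch reaches down to every `(T, t₀]`, `T > 0`
    left
    intro T hT0 hT
    obtain ⟨T', hT'S, hT'T⟩ := exists_lt_of_csInf_lt hne (by rw [← hα, ← hzero]; exact hT0)
    have hTS : T ∈ S := hup T T' hT'S hT'T.le hT
    exact ⟨(hβadm T hTS).2.1, (hβadm T hTS).2.2⟩
  · -- `α = inf S > 0` is an end
    right
    obtain ⟨T₁, hT₁⟩ := id hne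
    have hαt₀ : α < t₀ := (csInf_le hbdd hT₁).trans_lt hT₁.2.1
    have hloc : ∀ t ∈ Ioc α t₀, ∃ T ∈ S, T < t := fun t ht => exists_lt_of_csInf_lt hne ht.1
    have hcontα : ContinuousOn β (Ioc α t₀) := by
      intro t ht
      obtain ⟨T, hT, hTt⟩ := hloc t ht
      have h := (hβadm T hT).2.1 t ⟨hTt, ht.2⟩
      refine h.mono_of_mem_nhdsWithin ?_
      exact mem_of_superset (inter_mem_nhdsWithin (Ioc α t₀) (Ioi_mem_nhds hTt)) fun u hu => ⟨hu.2, hu.1.2⟩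
    have hsolα : ∀ t ∈ Ioc α t₀, 0 < β t ∧ MvPolynomial.eval ![t, β t] Φ = 0 := by
      intro t ht
      obtain ⟨T, hT, hTt⟩ := hloc t ht
      exact (hβadm T hT).2.2 t ⟨hTt, ht.2⟩
    refine ⟨α, hpos, hαt₀, hcontα, hsolα, ?_⟩
    have hcontIoo : ContinuousOn β (Ioo α t₀) := hcontα.mono Ioo_subset_Ioc_self
    have hsolIoo : ∀ t ∈ Ioo α t₀, MvPolynomial.eval ![t, β t] Φ = 0 := fun t ht => (hsolα t ⟨ht.1, ht.2.le⟩).2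
    have hposF : ∀ᶠ t in 𝓝[>] α, 0 < β t :=
      mem_of_superset (Ioo_mem_nhdsGT hαt₀) fun t ht => (hsolα t ⟨ht.1, ht.2.le⟩).1
    rcases tendsto_of_not_oscillating hposF (fun b₁ b₂ hb h₁ h₂ =>
        not_oscillating_left_end Φ P hP hfin hpos hαt₀ hb hcontIoo hsolIoo h₁ h₂) with htop | ⟨c, hc0, hc⟩
    · exact Or.inr htop
    rcases hc0.lt_or_eq with hcpos | hczero
    · exfalso
      obtain ⟨δ, hδ, β', hβ'eq, -, hβ'cont, hβ'sol, hβ'pos⟩ :=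
        exists_extension_of_tendsto_left Φ P hP hsplit hfin hgp hpos hαt₀ hcpos hcontIoo hsolIoo hc
      let γ : ℝ → ℝ := fun t => if α < t then β t else β' t
      have hγβ' : ∀ u ∈ Ioo (α - δ) t₀, γ u = β' u := by
        intro u hu
        by_cases huα : α < u
        · simp only [γ, if_pos huα]; exact (hβ'eq u ⟨huα, hu.2⟩).symm
        · simp only [γ, if_neg huα]
      have hγβ : ∀ u, α < u → γ u = β u := fun u hu => by simp only [γ, if_pos hu]
      set T' := max (α - δ) 0 with hT'
      have hT'α : T' < α := max_lt (by linarith) hpos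
      have hmem : T' ∈ S := by
        refine ⟨le_max_right _ _, hT'α.trans hαt₀, γ, by rw [hγβ t₀ hαt₀, hβ0], ?_, ?_⟩
        · intro t ht
          have htδ : α - δ < t := (le_max_left _ _).trans_lt ht.1
          rcases eq_or_lt_of_le ht.2 with rfl | hlt
          · -- at `t₀`: locally `β` within the interval
            have h := (hcontα t ⟨hαt₀, le_rfl⟩).mono_of_mem_nhdsWithin (s := Ioc T' t) (by
              exact mem_of_superset (inter_mem_nhdsWithin (Ioc T' t) (Ioi_mem_nhds hαt₀))
                fun u hu => ⟨hu.2, hu.1.2⟩)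
            refine h.congr_of_eventuallyEq ?_ (hγβ t hαt₀)
            exact mem_of_superset (mem_nhdsWithin_of_mem_nhds (Ioi_mem_nhds hαt₀)) fun u hu => hγβ u hu
          · have hβ't : ContinuousAt β' t := (hβ'cont t ⟨htδ, hlt⟩).continuousAt (Ioo_mem_nhds htδ hlt)
            refine (hβ't.congr ?_).continuousWithinAt
            exact mem_of_superset (Ioo_mem_nhds htδ hlt) fun u hu => (hγβ' u hu).symm
        · intro t ht
          have htδ : α - δ < t := (le_max_left _ _).trans_lt ht.1
          by_cases htα : α < t
          · rw [hγβ t htα]; exact hsolα t ⟨htα, ht.2⟩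
          · push Not at htα
            rw [hγβ' t ⟨htδ, lt_of_le_of_lt htα hαt₀⟩]
            exact ⟨hβ'pos t ⟨htδ, htα⟩, hβ'sol t ⟨htδ, lt_of_le_of_lt htα hαt₀⟩⟩
      have : α ≤ T' := csInf_le hbdd hmem
      linarith
    · left
      rw [← hczero] at hc
      exact hc

end OsculationPeel

end Summit.ValiantsHypothesis.ValiantsHypothesis.Theorems.LacunarySymmetroidMatrixDescartes

end
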